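/-
Copyright (c) 2026 the pub-hodgecm-mathlib formalisation cell (harness21).  Prover seat hodgecm-mathlib-F0P3-p02 (g18): line LH3 (closer stub `stub_N9`), organ J,
sliver (b3) «hCMx ∕ hintx» of LH3-p02 (g3)'s (G′-SIDE) census (2026-09-02T08:56:59Z).
-/
import Literature.NumberTheory.Rogawski1990.ArchInnerFormChartOrbIntegrable    -- ★ p850356∕p850485 (F0P3a-p08 (g22)): `integrable_descConj_gprimeTorus_of_regG`; brings ★ p850470 SPLIT-DOCK (`uniformlyProper_gprimeTorus_of_semireg_split_of_regular`), ★ D4b-1β, ★ (T-MEAS-G′)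
import Literature.NumberTheory.Rogawski1990.ArchCayleyValueOfMembership      -- ★ p850419 (LH4-p01 (g3)) (V1-G′): the `x`-ray, `cayRay_apply_*`, `cayRay_mem_regG_insert` (+ ★ docks, ★ `ArchHCSpaceG`)
import HarnessLib

/-!
# (J-G′-BLOCK-β-ν): the two eventual binders of ★ (J-G′-BLOCK-β) along the `x`-ray of the Cayley chart — ONE compact `C″` modulo `Z(γ_p)`, integrability for `x > 0`
# (Rogawski 1990 §4.12 Lemma 4.12.1, §8.2; Harish-Chandra–van Dijk 1970 Part I §3 Lemma 22; Shelstad 1979 §4)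

Topic `NumberTheory/Rogawski1990`; namespace `Literature.NumberTheory.Rogawski1990`.  THEOREMS ONLY (no `def`, no instance, no notation, no axiom, no named fact, no `sorry`);
kernel lane `--kind proof --supports stmt-HodgeConjecture-24833`.  Cell `pub/hodgecm-mathlib`, crux H413 (`stmt-HodgeConjecture-24833`), F0∕P3c line LH3 (closer stub `stub_N9`,
DIRECT ROAD `F0_P3c_StubN9Direct`, organ J, residual stub `stub_N9jumpGSide`), sliver **(b3) «hCMx ∕ hintx»** of LH3-p02 (g3)'s (G′-SIDE) census (2026-09-02T08:56:59Z; seat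
F0P3-p02 (g18)) — the Cayley-chart twin of ★ (J-G′-BLOCK-ν) `ArchChartOrbGBlockNormalBinders` (p850667, this seat): the two EVENTUAL hypotheses of ★ (J-G′-BLOCK-β)
`exists_block_testFunction_chartOrbG_xRay_eventuallyEq` ∕ `chartOrbG_xRay_eventuallyEq_descended_of_cutoff` (p850444, F0P3b-p01 (g15)) along the `x`-RAY
`c_x = hcCayPt w₀ 0 2 p + x • e_{w₀,0}` of the split chart `S♯ = insert w₀ S` through the wall point `γ_p = gprimeTorus S p` (= the Cayley point, ★ `gprimeTorus_of_wall`), at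
`s := γ_p`, DISCHARGED hypothesis-free:
* `hCMx` — ONE compact `C″` with `y′ · gprimeTorus S♯ c_x · y′⁻¹ ∈ C′ ⇒ y′ ∈ C″ · Z(γ_p)` for ALL `|x| ≤ 1` (hence eventually): ★ SPLIT-DOCK `uniformlyProper_gprimeTorus_of_semireg_split_of_regular`
  (p850470, F0P3a-p08 (g22); ★ D4b-1β) on the compact ray segment — NO smallness is needed on the Cayley chart: along the ray the simple eigenvalue `e^{iφ}` (`|·| = 1`) never meets
  the boost pair `e^{±x+iθ}` (`|·| = e^{±x}`; at `x = 0` by semiregularity `e^{iφ} ≠ e^{iθ}`), and the other places are frozen at the regular `p`;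
* `hintx` — for `x > 0` the ray is `G`-regular (★ `cayRay_mem_regG_insert`, p850419) and ★ `integrable_descConj_gprimeTorus_of_regG` (p850485) applies on the admissible chart `S♯`.

* §1 `gprimeTorus_insert_hcCayPt_eq` (the Cayley point of `S♯` IS the wall point `γ_p`), `cexp_mul_I_ne_boostPair` (`e^{iφ} ≠ e^{±x+iθ}` from `e^{iφ} ≠ e^{iθ}` on the circle),
  `boostEig_cayRay_one_ne`;
* §2 **`exists_isCompact_mul_centralizer_nhds_cayRay`** (`hCMx` on `𝓝 0`, any compact `C′`);  §3 **`eventually_integrable_descConj_cayRay`** (`hintx` on `𝓝[>] 0`);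
* §4 **`exists_cayRay_binders`** — both at once with `C′ := tsupport a′`, on `𝓝[>] 0`, in ★ p850444's binder spelling at `s := gprimeTorus L α S p`.
HONEST LABEL: HC_CM is proved only modulo the 7 printed citations (2 remaining named inputs: hLiu418 = `stmt-HodgeConjecture-24832`, h413 = `stmt-HodgeConjecture-24833`) until rung 0
closes; count-neutral topology under organ J of `stub_N9` (no stub closes by this file alone).

## References
* [Rogawski1990] J. D. Rogawski, *Automorphic Representations of Unitary Groups in Three Variables*, Ann. of Math. Stud. 123 (1990), §4.12 Lemma 4.12.1 p. 66, §8.2 pp. 114,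
  122–124 (the split torus through the Cayley point; orbital integrals near `x = 0`).
* [HarishChandra1970] Harish-Chandra (notes by G. van Dijk), *Harmonic Analysis on Reductive p-adic Groups*, LNM 162 (1970), Part I §3 Lemma 22.
* [Shelstad1979] D. Shelstad, *Characters and inner forms of a quasi-split group over ℝ*, Compositio Math. 39 (1979), §4 pp. 22–25 (the Cayley transform, the ray `x → 0`).
* [DeitmarEchterhoff2014] A. Deitmar, S. Echterhoff, *Principles of Harmonic Analysis*, 2nd ed. (2014), Lemma 9.3.3, Remark 1.5.2.
-/

set_option autoImplicit false

noncomputable section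

open MeasureTheory MeasureTheory.Measure Set Filter Topology NumberField NumberField.InfinitePlace Complex
open Literature.MeasureTheory.Group Literature.NumberTheory.Automorphic Literature.NumberTheory.Automorphic.UnitaryGroup Literature.NumberTheory.Automorphic.ArchCartan
open scoped MatrixGroups Matrix Pointwise Classical

namespace Literature.NumberTheory.Rogawski1990

/-! ## §1 The Cayley point is the wall point; the simple eigenvalue never meets the boost pair -/

section Wall

variable (L : Type) [Field L] [NumberField L] [IsCMField L] (α : Fin 3 → L)
  {S : Finset {w : InfinitePlace L // IsComplex w}} {w₀ : {w : InfinitePlace L // IsComplex w}} {p : {w : InfinitePlace L // IsComplex w} → Fin 3 → ℝ}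

/-- **The Cayley point of the split chart `insert w₀ S` IS the compact chart's wall point**: `gprimeTorus (insert w₀ S) (hcCayPt w₀ 0 2 p) = gprimeTorus S p` ON the wall
`p w₀ 0 = p w₀ 2` (★ `gprimeTorus_of_wall` + ★ `hcCayPt_eq_of_wall`). [cite: Shelstad1979, §4 p. 25] [cite: Rogawski1990, §3.6 p. 31] -/
theorem gprimeTorus_insert_hcCayPt_eq (hw₀ : w₀ ∉ S) (hsp : w₀ ∈ splitChartPlaces L α) (hp : p w₀ 0 = p w₀ 2) :
    gprimeTorus L α (insert w₀ S) (hcCayPt w₀ 0 2 p) = gprimeTorus L α S p := by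
  rw [hcCayPt_eq_of_wall hp, hcThird_zero_two, ← gprimeTorus_of_wall L α hw₀ hsp hp]

end Wall

/-- **`e^{iφ} ≠ e^{±x+iθ}` for every real `x`, as soon as `e^{iφ} ≠ e^{iθ}` on the circle** (norms: `1` versus `e^{±x}` forces `x = 0`). [cite: Rogawski1990, §8.2 p. 122]
[cite: Shelstad1979, §4 p. 22] -/
theorem cexp_mul_I_ne_boostPair {θ φ : ℝ} (h : Circle.exp θ ≠ Circle.exp φ) (x : ℝ) :
    Complex.exp ((φ : ℂ) * I) ≠ Complex.exp ((x : ℂ) + (θ : ℂ) * I) ∧ Complex.exp ((φ : ℂ) * I) ≠ Complex.exp (-(x : ℂ) + (θ : ℂ) * I) := by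
  have key : ∀ y : ℝ, Complex.exp ((φ : ℂ) * I) ≠ Complex.exp ((y : ℂ) + (θ : ℂ) * I) := by
    intro y heq
    have hn := congrArg (fun z : ℂ => ‖z‖) heq
    simp only [Complex.norm_exp, Complex.add_re, Complex.ofReal_re, Complex.mul_re, Complex.I_re, Complex.ofReal_im, Complex.I_im,
      mul_zero, mul_one, sub_zero, add_zero] at hn
    have hy : y = 0 := (Real.exp_eq_exp.1 hn.symm)
    rw [hy, Complex.ofReal_zero, zero_add] at heq
    exact h (Subtype.ext (by rw [Circle.coe_exp, Circle.coe_exp]; exact heq.symm))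
  refine ⟨key x, ?_⟩
  have h' := key (-x)
  rwa [Complex.ofReal_neg] at h'

/-- **Along the `x`-ray the simple eigenvalue stays simple**: for the ray coordinates `cw = (x, p_{w₀,1}, p_{w₀,0})` at `w₀`, `boostEig cw 1 ≠ boostEig cw j` for `j ≠ 1` — from the
semiregularity `e^{i p_{w₀,1}} ≠ e^{i p_{w₀,0}}` alone, for EVERY `x`. [cite: Shelstad1979, §4 p. 22] [cite: Rogawski1990, §8.2 p. 122] -/
theorem boostEig_cayRay_one_ne {W : Type*} [DecidableEq W] {S : Finset W} {w₀ : W} {p : W → Fin 3 → ℝ} (hp : HcSemireg S w₀ 0 2 p) (x : ℝ) :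
    ∀ j : Fin 3, j ≠ 1 →
      boostEig ((hcCayPt w₀ 0 2 p + x • (Pi.single w₀ (Pi.single 0 1 : Fin 3 → ℝ) : W → Fin 3 → ℝ)) w₀) 1 ≠
        boostEig ((hcCayPt w₀ 0 2 p + x • (Pi.single w₀ (Pi.single 0 1 : Fin 3 → ℝ) : W → Fin 3 → ℝ)) w₀) j := by
  have h01 : Circle.exp (p w₀ 0) ≠ Circle.exp (p w₀ 1) := by
    have h := hp.2.1
    rw [hcThird_zero_two] at h
    exact h.symm
  have hne := cexp_mul_I_ne_boostPair h01 x
  have h0 : (hcCayPt w₀ 0 2 p + x • (Pi.single w₀ (Pi.single 0 1 : Fin 3 → ℝ) : W → Fin 3 → ℝ)) w₀ 0 = x := cayRay_apply_self_zero p w₀ 0 2 x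
  have h1 : (hcCayPt w₀ 0 2 p + x • (Pi.single w₀ (Pi.single 0 1 : Fin 3 → ℝ) : W → Fin 3 → ℝ)) w₀ 1 = p w₀ 1 := by
    rw [cayRay_apply_self_one, hcThird_zero_two]
  have h2 : (hcCayPt w₀ 0 2 p + x • (Pi.single w₀ (Pi.single 0 1 : Fin 3 → ℝ) : W → Fin 3 → ℝ)) w₀ 2 = p w₀ 0 := by
    rw [cayRay_apply_self_two, ← hp.1, add_self_div_two]
  intro j hj
  fin_cases j
  · simp only [boostEig, h0, h1, h2, Matrix.cons_val_one, Matrix.cons_val_zero]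
    exact hne.1
  · exact absurd rfl hj
  · simp only [boostEig, h0, h1, h2, Matrix.cons_val_one, Matrix.cons_val_zero]
    exact hne.2

/-! ## §2 One compact modulo `Z(γ_p)` for the whole ray segment -/

section Binders

variable (L : Type) [Field L] [NumberField L] [IsCMField L] (α : Fin 3 → L)
  (S : Finset {w : InfinitePlace L // IsComplex w}) (w₀ : {w : InfinitePlace L // IsComplex w}) (p : {w : InfinitePlace L // IsComplex w} → Fin 3 → ℝ)

/-- **`hCMx` — HARISH-CHANDRA'S COMPACTNESS LEMMA ALONG THE `x`-RAY, hypothesis-free**: at a semiregular point `p` of the compact wall `(w₀, 0, 2)` of an admissible chart `S`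
(`w₀ ∉ S` a split-chart place), for every compact `C′ ⊆ G′_∞` there is ONE compact `C″` with `y′ · gprimeTorus (insert w₀ S) (hcCayPt p + x • e_{w₀,0}) · y′⁻¹ ∈ C′ ⇒ y′ ∈ C″ · Z(γ_p)`
for all `x` near `0` (indeed all `|x| ≤ 1`; ★ SPLIT-DOCK `uniformlyProper_gprimeTorus_of_semireg_split_of_regular` at the Cayley point `hcCayPt p` — `x_{w₀} = 0` — whose centraliser is
`Z(γ_p)` by §1). [cite: Rogawski1990, §4.12 Lemma 4.12.1 p. 66; §8.2 pp. 114, 122] [cite: HarishChandra1970, Part I §3 Lemma 22] [cite: Shelstad1979, §4 p. 25]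
[cite: DeitmarEchterhoff2014, Remark 1.5.2] -/
theorem exists_isCompact_mul_centralizer_nhds_cayRay (hα : ∀ i, α i ≠ 0)
    (hS : ∀ w, w ∈ S → w ∈ splitChartPlaces L α) (hw₀ : w₀ ∉ S) (hsp : w₀ ∈ splitChartPlaces L α) (hp : HcSemireg S w₀ 0 2 p)
    {C' : Set ↥(arch (↥(maximalRealSubfield L)) L (IsCMField.complexConj L) 3 (Matrix.diagonal α))} (hC' : IsCompact C') :
    ∃ C'' : Set ↥(arch (↥(maximalRealSubfield L)) L (IsCMField.complexConj L) 3 (Matrix.diagonal α)), IsCompact C'' ∧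
      ∀ᶠ x in 𝓝 (0 : ℝ), ∀ y' : ↥(arch (↥(maximalRealSubfield L)) L (IsCMField.complexConj L) 3 (Matrix.diagonal α)),
        y' * gprimeTorus L α (insert w₀ S) (hcCayPt w₀ 0 2 p + x • (Pi.single w₀ (Pi.single 0 1 : Fin 3 → ℝ) : {w : InfinitePlace L // IsComplex w} → Fin 3 → ℝ)) * y'⁻¹ ∈ C' →
          y' ∈ C'' * ((Subgroup.centralizer ({gprimeTorus L α S p} : Set ↥(arch (↥(maximalRealSubfield L)) L (IsCMField.complexConj L) 3 (Matrix.diagonal α)))) :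
            Set ↥(arch (↥(maximalRealSubfield L)) L (IsCMField.complexConj L) 3 (Matrix.diagonal α))) := by
  have hS' : ∀ w, w ∈ insert w₀ S → w ∈ splitChartPlaces L α := fun w hw =>
    (Finset.mem_insert.1 hw).elim (fun h => h ▸ hsp) (hS w)
  have hx0 : hcCayPt w₀ 0 2 p w₀ 0 = 0 := hcCayPt_apply_self_zero w₀ 0 2 p
  have hp' : ∀ w, w ≠ w₀ → w ∈ insert w₀ S ∧ w ∈ splitChartPlaces L α → hcCayPt w₀ 0 2 p w 0 ≠ 0 := fun w hw hws => by
    rw [hcCayPt_apply_of_ne hw]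
    exact hp.2.2.2 w (Finset.mem_of_mem_insert_of_ne hws.1 hw)
  -- the compact ray segment and the place sets
  have hKc : IsCompact ((fun x : ℝ => hcCayPt w₀ 0 2 p + x • (Pi.single w₀ (Pi.single 0 1 : Fin 3 → ℝ) : {w : InfinitePlace L // IsComplex w} → Fin 3 → ℝ)) '' Set.Icc (-1) 1) :=
    isCompact_Icc.image (continuous_const.add (continuous_id.smul continuous_const))
  have hKS : (fun x : ℝ => hcCayPt w₀ 0 2 p + x • (Pi.single w₀ (Pi.single 0 1 : Fin 3 → ℝ) : {w : InfinitePlace L // IsComplex w} → Fin 3 → ℝ)) '' Set.Icc (-1) 1 ⊆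
      Set.pi Set.univ (fun w : {w : InfinitePlace L // IsComplex w} => {cw : Fin 3 → ℝ |
        (w = w₀ → ∀ j : Fin 3, j ≠ 1 → boostEig cw 1 ≠ boostEig cw j) ∧
        (w ∉ insert w₀ S → Function.Injective fun l : Fin 3 => Circle.exp (cw l)) ∧ (w ≠ w₀ → w ∈ S → cw 0 ≠ 0)}) := by
    rintro _ ⟨x, -, rfl⟩ w -
    dsimp only
    refine ⟨fun hw => ?_, fun hwS => ?_, fun hww hwS => ?_⟩
    · rw [hw]
      exact boostEig_cayRay_one_ne hp x
    · rw [Finset.mem_insert, not_or] at hwS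
      rw [cayRay_apply_of_ne p hwS.1]
      exact hp.2.2.1 w hwS.2 hwS.1
    · rw [cayRay_apply_of_ne p hww]
      exact hp.2.2.2 w hwS
  obtain ⟨𝒦', h𝒦', hmem𝒦⟩ := uniformlyProper_gprimeTorus_of_semireg_split_of_regular L α (insert w₀ S) hα (hcCayPt w₀ 0 2 p) w₀ (Finset.mem_insert_self w₀ S) hsp hx0 hp'
    (fun w : {w : InfinitePlace L // IsComplex w} => {cw : Fin 3 → ℝ |
        (w = w₀ → ∀ j : Fin 3, j ≠ 1 → boostEig cw 1 ≠ boostEig cw j) ∧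
        (w ∉ insert w₀ S → Function.Injective fun l : Fin 3 => Circle.exp (cw l)) ∧ (w ≠ w₀ → w ∈ S → cw 0 ≠ 0)})
    (fun cw hcw => hcw.1 rfl) (fun w hws cw hcw => hcw.2.1 (fun hwS => hws ⟨hwS, hS' w hwS⟩)) (fun w hw hws cw hcw => hcw.2.2 hw (Finset.mem_of_mem_insert_of_ne hws.1 hw))
    _ hKS hKc C' hC'
  obtain ⟨C'', hC'', hsub⟩ := exists_isCompact_image_mk_superset
    (Subgroup.centralizer ({gprimeTorus L α (insert w₀ S) (hcCayPt w₀ 0 2 p)} : Set ↥(arch (↥(maximalRealSubfield L)) L (IsCMField.complexConj L) 3 (Matrix.diagonal α)))) h𝒦'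
  refine ⟨C'', hC'', ?_⟩
  rw [← gprimeTorus_insert_hcCayPt_eq L α hw₀ hsp hp.1]
  filter_upwards [Icc_mem_nhds (show (-1 : ℝ) < 0 by norm_num) (show (0 : ℝ) < 1 by norm_num)] with x hx y' hy'
  obtain ⟨a, ha, hay⟩ := hsub (hmem𝒦 _ ⟨x, hx, rfl⟩ y' hy')
  rw [QuotientGroup.eq] at hay
  exact ⟨a, ha, a⁻¹ * y', hay, by group⟩

/-! ## §3 Integrability for `x > 0` -/

variable [MeasurableSpace ↥(arch (↥(maximalRealSubfield L)) L (IsCMField.complexConj L) 3 (Matrix.diagonal α))]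
  [BorelSpace ↥(arch (↥(maximalRealSubfield L)) L (IsCMField.complexConj L) 3 (Matrix.diagonal α))]
  (ν' : Measure ↥(arch (↥(maximalRealSubfield L)) L (IsCMField.complexConj L) 3 (Matrix.diagonal α))) [ν'.IsHaarMeasure] [ν'.IsMulRightInvariant]
  {a' : ↥(arch (↥(maximalRealSubfield L)) L (IsCMField.complexConj L) 3 (Matrix.diagonal α)) → ℂ}

/-- **`hintx` — THE CHART INTEGRAND ALONG THE `x`-RAY IS INTEGRABLE FOR SMALL `x > 0`** (indeed every `x ≠ 0`): the ray is `G`-regular off `x = 0` (★ `cayRay_mem_regG_insert`) and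
at regular points of the admissible chart `insert w₀ S` the integrand of `chartOrbG` is integrable (★ `integrable_descConj_gprimeTorus_of_regG`).
[cite: Rogawski1990, §8.2 p. 122; §4.3 p. 43] [cite: DeitmarEchterhoff2014, Lemma 9.3.3] [cite: HarishChandra1970, Part I §3 Lemma 22] -/
theorem eventually_integrable_descConj_cayRay (hα : ∀ i, α i ≠ 0) (hS : ∀ w, w ∈ S → w ∈ splitChartPlaces L α) (hsp : w₀ ∈ splitChartPlaces L α)
    (hp : HcSemireg S w₀ 0 2 p) (ha'c : Continuous a') (ha's : HasCompactSupport a') :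
    ∀ᶠ x in 𝓝[>] (0 : ℝ), Integrable (descConj (gprimeTorus L α (insert w₀ S) (hcCayPt w₀ 0 2 p + x • (Pi.single w₀ (Pi.single 0 1 : Fin 3 → ℝ) : {w : InfinitePlace L // IsComplex w} → Fin 3 → ℝ)))
      (chartTorusG L α (insert w₀ S)) (forall_mem_chartTorusG_comm L α (insert w₀ S) _) a') (chartQuotientMeasureG L α ν' (insert w₀ S)) := by
  have hS' : ∀ w, w ∈ insert w₀ S → w ∈ splitChartPlaces L α := fun w hw =>
    (Finset.mem_insert.1 hw).elim (fun h => h ▸ hsp) (hS w)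
  letI : MeasurableSpace (↥(arch (↥(maximalRealSubfield L)) L (IsCMField.complexConj L) 3 (Matrix.diagonal α)) ⧸ chartTorusG L α (insert w₀ S)) := borel _
  haveI : BorelSpace (↥(arch (↥(maximalRealSubfield L)) L (IsCMField.complexConj L) 3 (Matrix.diagonal α)) ⧸ chartTorusG L α (insert w₀ S)) := ⟨rfl⟩
  haveI := isMulLeftInvariant_chartHaarG L α (insert w₀ S)
  haveI := isFiniteMeasureOnCompacts_chartHaarG L α (insert w₀ S)
  haveI := isOpenPosMeasure_chartHaarG L α (insert w₀ S)
  haveI := isInvInvariant_chartHaarG L α (insert w₀ S)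
  have hq : chartQuotientMeasureG L α ν' (insert w₀ S) =
      quotientMeasure (chartTorusG L α (insert w₀ S)) (chartHaarG L α (insert w₀ S)) (isClosed_chartTorusG L α (insert w₀ S)) ν' := rfl
  haveI : IsFiniteMeasureOnCompacts (chartQuotientMeasureG L α ν' (insert w₀ S)) := by rw [hq]; infer_instance
  filter_upwards [self_mem_nhdsWithin] with x hx
  exact integrable_descConj_gprimeTorus_of_regG L α (insert w₀ S) hα hS' (cayRay_mem_regG_insert hp (ne_of_gt hx)) ha'c ha's _

/-! ## §4 Both binders of ★ (J-G′-BLOCK-β), in its spelling -/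

/-- **(J-G′-BLOCK-β-ν) — THE TWO EVENTUAL BINDERS OF ★ `exists_block_testFunction_chartOrbG_xRay_eventuallyEq` AT `s := γ_p = gprimeTorus L α S p`, hypothesis-free**: ONE compact
`C″` with, for small `x > 0`, (`hCMx`) `y′ · gprimeTorus (insert w₀ S) (hcCayPt p + x • e_{w₀,0}) · y′⁻¹ ∈ tsupport a′ ⇒ y′ ∈ C″ · Z(γ_p)` and (`hintx`) integrability of the chart integrand
on the ray.  With ★ (J-G′-BLOCK-ν) `exists_blockNormal_binders` (compact chart) the consumer picks ONE cut-off `β` for `C″_S ∪ C″_♯` and feeds ★ p850417 ∕ ★ p850444 at the SAME `s`,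
`νM`, `β` (cross-chart consistency). [cite: Rogawski1990, §4.12 Lemma 4.12.1 p. 66; §8.2 pp. 114, 122] [cite: HarishChandra1970, Part I §3 Lemma 22] [cite: Shelstad1979, §4 pp. 22–25] -/
theorem exists_cayRay_binders (hα : ∀ i, α i ≠ 0) (hS : ∀ w, w ∈ S → w ∈ splitChartPlaces L α) (hw₀ : w₀ ∉ S) (hsp : w₀ ∈ splitChartPlaces L α)
    (hp : HcSemireg S w₀ 0 2 p) (ha'c : Continuous a') (ha's : HasCompactSupport a') :
    ∃ C'' : Set ↥(arch (↥(maximalRealSubfield L)) L (IsCMField.complexConj L) 3 (Matrix.diagonal α)), IsCompact C'' ∧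
      (∀ᶠ x in 𝓝[>] (0 : ℝ), ∀ y' : ↥(arch (↥(maximalRealSubfield L)) L (IsCMField.complexConj L) 3 (Matrix.diagonal α)),
        y' * gprimeTorus L α (insert w₀ S) (hcCayPt w₀ 0 2 p + x • (Pi.single w₀ (Pi.single 0 1 : Fin 3 → ℝ) : {w : InfinitePlace L // IsComplex w} → Fin 3 → ℝ)) * y'⁻¹ ∈ tsupport a' →
          y' ∈ C'' * ((Subgroup.centralizer ({gprimeTorus L α S p} : Set ↥(arch (↥(maximalRealSubfield L)) L (IsCMField.complexConj L) 3 (Matrix.diagonal α)))) :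
            Set ↥(arch (↥(maximalRealSubfield L)) L (IsCMField.complexConj L) 3 (Matrix.diagonal α)))) ∧
      (∀ᶠ x in 𝓝[>] (0 : ℝ), Integrable (descConj (gprimeTorus L α (insert w₀ S) (hcCayPt w₀ 0 2 p + x • (Pi.single w₀ (Pi.single 0 1 : Fin 3 → ℝ) : {w : InfinitePlace L // IsComplex w} → Fin 3 → ℝ)))
        (chartTorusG L α (insert w₀ S)) (forall_mem_chartTorusG_comm L α (insert w₀ S) _) a') (chartQuotientMeasureG L α ν' (insert w₀ S))) := by
  obtain ⟨C'', hC'', hCM⟩ := exists_isCompact_mul_centralizer_nhds_cayRay L α S w₀ p hα hS hw₀ hsp hp ha's.isCompact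
  exact ⟨C'', hC'', nhdsWithin_le_nhds hCM, eventually_integrable_descConj_cayRay L α S w₀ p ν' hα hS hsp hp ha'c ha's⟩

end Binders

end Literature.NumberTheory.Rogawski1990

end
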